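import Summits.ValiantsHypothesis.ValiantsHypothesis.Theorems.NcSkewCombTyped
import HarnessLib

/-!
# Skew circuits inside comb-typed rotation-UPT normal form, 2/2: semantics, the arrow, transfers

Helper file of the KERNEL ARROW `SKEW ⊆ rot-NF(comb)` (restricted-models ladder of
`CommutativityDial`; item `PerNotNcVP` / A_nc untouched, OPEN). MODEL: rotUPT = rotation-UPT
NORMAL FORM: circuits typed by a shape T in which every product gate multiplies an operand typed
by its left child and one typed by its right child IN EITHER ORDER (GateRot = LLS18 Prop 7 typing
+ the rotated product); the conversion of an arbitrary rotUPT circuit (LLS18 §4: all parse trees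
rotations of one tree) to this normal form (gate duplication per node, poly blow-up) is NOT
formalised. THIS FILE: the degree toolkit; the BLOCK INVARIANT of the folklore homogenising
translation `skewHom d P` of part 1/2 (slot `(j,k)` = the degree-`k` component of gate `j`, HWY
Lemma 3.3 for fan-in-two SKEW circuits, degree `0` only through the weights `κ_j`); THE ARROW:
every fan-in-two skew circuit of size `s` computing a homogeneous polynomial of degree `d ≥ 1` is
computed by a circuit rot-typed by the LEFT COMB with `d` leaves (UPT-typed if it has no rotated
product `x · g_j`) of size `(d+1)(s+1)` — it says nothing about general circuits (a product of two
gate slots is not comb-typable: every comb node has a LEAF as right child) nor about untyped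
ones; NON-VACUOUS: `x · y` (`d = 2`), monomial chains and the `n · n!`-gate row expansion of
`PERM_n` are homogeneous fan-in-two skew circuits. TRANSFERS through `lidPoly_rot`: `LID_r` and
`PERM_n` (`n ≥ 4r`) for skew circuits, `2^{(r+1)/3} ≤ 4r(4r+1)(s+1)` — WEAKER than `lidPoly_skew`
/ `ncPerPoly_skew`, their content is the factorisation SKEW → rot-NF(comb) → `lidPoly_rot`; NOT
a new lower bound; 0 S-currency; closes NO item; `A_nc` stmt-23446 / `PerNotNcVP` / VP ≠ VNP
untouched. [cite: HrubesWigdersonYehudayoff2010, Lemma 3.3, §A]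
[cite: LagardeLimayeSrinivasan2018, §3 Prop 7, §4 Thm 17] [cite: LimayeMalodSrinivasan2016, §7]
[cite: Nisan1991Noncommutative, §2]
-/

noncomputable section

namespace Summit.ValiantsHypothesis.ValiantsHypothesis.Theorems.NcSkewCombTypedPermanent

set_option linter.dupNamespace false

open Literature.Computability.AlgebraicComplexity
  Literature.Computability.AlgebraicComplexity.ArithCircuit
  Summit.ValiantsHypothesis.ValiantsHypothesis.Theorems.NcAutomatonIntersection
  Summit.ValiantsHypothesis.ValiantsHypothesis.Theorems.NcCentralWidth
  Summit.ValiantsHypothesis.ValiantsHypothesis.Theorems.NcSOSDegreeFour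
  Summit.ValiantsHypothesis.ValiantsHypothesis.Theorems.NcBlockForms
  Summit.ValiantsHypothesis.ValiantsHypothesis.Theorems.NcCayleyDeterminant
  Summit.ValiantsHypothesis.ValiantsHypothesis.Theorems.NcSOSPermanent
  Summit.ValiantsHypothesis.ValiantsHypothesis.Theorems.NcPalindromePower
  Summit.ValiantsHypothesis.ValiantsHypothesis.Theorems.NcUniqueParseTree
  Summit.ValiantsHypothesis.ValiantsHypothesis.Theorems.NcRotParseTree
  Summit.ValiantsHypothesis.ValiantsHypothesis.Theorems.NcRotParseTreePermanent
  Summit.ValiantsHypothesis.ValiantsHypothesis.Theorems.NcSkewCombTyped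

universe u v w

section Semantics
variable {R : Type u} [CommSemiring R] {σ : Type v}

/-- The degree-`0` component is the constant coefficient. [cite: HrubesWigdersonYehudayoff2010] -/
theorem degPart_zero_eq (d : ℕ) (f : FreeAlgebra R σ) :
    degPart d 0 f = algebraMap R (FreeAlgebra R σ) (FreeAlgebra.algebraMapInv f) := by
  induction f using FreeAlgebra.induction with
  | grade0 r =>
    rw [FreeAlgebra.algebraMap_leftInverse r]
    unfold degPart
    rw [dfaProj_algebraMap, if_pos (Fin.ext (by simp))]
  | grade1 x => simpa [FreeAlgebra.algebraMapInv] using degPart_word (R := R) (Nat.zero_le d) [x]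
  | mul a b ha hb =>
    rw [map_mul FreeAlgebra.algebraMapInv, map_mul (algebraMap R (FreeAlgebra R σ)), ← ha, ← hb,
      degPart_mul d (Nat.zero_le d), Finset.sum_eq_single (⟨0, by omega⟩ : Fin (d + 2))]
    · simp
    · intro c _ hc; rw [if_neg fun h => hc (Fin.ext (Nat.le_zero.1 h)), mul_zero]
    · exact fun h => absurd (Finset.mem_univ _) h
  | add a b ha hb => rw [map_add, map_add, map_add, ha, hb]

/-- Letters have no constant coefficient. [cite: HrubesWigdersonYehudayoff2010, §A] -/
theorem degPart_zero_ι (d : ℕ) (x : σ) : degPart (R := R) d 0 (FreeAlgebra.ι R x) = 0 := by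
  simpa using degPart_word (R := R) (Nat.zero_le d) [x]

/-- `(p · x)_k = p_{k-1} · x` (`1 ≤ k ≤ d`). [cite: HrubesWigdersonYehudayoff2010, §A] -/
theorem degPart_mul_ι {d k : ℕ} (hk : 1 ≤ k) (hkd : k ≤ d) (p : FreeAlgebra R σ) (x : σ) :
    degPart d k (p * FreeAlgebra.ι R x) = degPart d (k - 1) p * FreeAlgebra.ι R x := by
  rw [degPart_mul d hkd, Finset.sum_eq_single (⟨k - 1, by omega⟩ : Fin (d + 2))]
  · dsimp only; rw [if_pos (Nat.sub_le k 1), Nat.sub_sub_self hk, degPart_one_ι (by omega)]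
  · intro c _ hc; have hc' : c.1 ≠ k - 1 := fun h => hc (Fin.ext h)
    split_ifs with h
    · by_cases h' : c.1 = k
      · rw [h', Nat.sub_self, degPart_zero_ι, mul_zero]
      · rw [degPart_ι_eq_zero (by omega) (by omega), mul_zero]
    · rw [mul_zero]
  · exact fun h => absurd (Finset.mem_univ _) h

/-- `(x · p)_k = x · p_{k-1}` (`1 ≤ k ≤ d`). [cite: HrubesWigdersonYehudayoff2010, §A] -/
theorem degPart_ι_mul {d k : ℕ} (hk : 1 ≤ k) (hkd : k ≤ d) (x : σ) (p : FreeAlgebra R σ) :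
    degPart d k (FreeAlgebra.ι R x * p) = FreeAlgebra.ι R x * degPart d (k - 1) p := by
  rw [degPart_mul d hkd, Finset.sum_eq_single (⟨1, by omega⟩ : Fin (d + 2))]
  · dsimp only; rw [if_pos hk, degPart_one_ι (by omega)]
  · intro c _ hc; have hc' : c.1 ≠ 1 := fun h => hc (Fin.ext h)
    split_ifs with h
    · by_cases h0 : c.1 = 0
      · rw [h0, degPart_zero_ι, zero_mul]
      · rw [degPart_ι_eq_zero (by omega) (by omega), zero_mul]
    · rw [mul_zero]
  · exact fun h => absurd (Finset.mem_univ _) h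

/-- `p · c = c • p` for a scalar `c`. [cite: HrubesWigdersonYehudayoff2010, §A] -/
theorem mul_algebraMap_eq_smul (p : FreeAlgebra R σ) (c : R) :
    p * algebraMap R (FreeAlgebra R σ) c = c • p :=
  ((Algebra.smul_def c p).trans (Algebra.commutes c p)).symm

/-- `c · p = c • p` for a scalar `c`. [cite: HrubesWigdersonYehudayoff2010, §A] -/
theorem algebraMap_mul_eq_smul (c : R) (p : FreeAlgebra R σ) :
    algebraMap R (FreeAlgebra R σ) c * p = c • p :=
  (Algebra.smul_def c p).symm

/-- Helper: slot `(j, k)`, `j < i`, lies below `(d+1) i`. [cite: HrubesWigdersonYehudayoff2010] -/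
theorem hix_lt {d j k i : ℕ} (hj : j < i) (hk : k ≤ d) : hix d j k < (d + 1) * i :=
  calc hix d j k < (j + 1) * (d + 1) := by unfold hix; rw [add_one_mul]; omega
    _ ≤ i * (d + 1) := Nat.mul_le_mul_right _ (Nat.succ_le_of_lt hj)
    _ = (d + 1) * i := Nat.mul_comm _ _

/-- Operands reading only the first `|V|` gates ignore the rest. [cite: Nisan1991Noncommutative] -/
theorem operand_ncEval_append {V : List (FreeAlgebra R σ)} (W : List (FreeAlgebra R σ))
    {u : Operand R σ} (hu : u.RefsBelow V.length) : u.ncEval (V ++ W) = u.ncEval V := by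
  rcases u with x | c | j <;> first | rfl | exact List.getD_append _ _ _ _ hu

/-- Gates reading only the first `|V|` gates ignore later ones. [cite: Nisan1991Noncommutative] -/
theorem gate_ncEval_append {V : List (FreeAlgebra R σ)} (W : List (FreeAlgebra R σ))
    {g : Gate R σ} (hg : ∀ u ∈ g.args, u.RefsBelow V.length) : g.ncEval (V ++ W) = g.ncEval V := by
  rcases g with args | args <;> simp only [Gate.ncEval]
  · exact congrArg List.sum (List.map_congr_left fun a ha => by
      rw [operand_ncEval_append W (hg a.2 (List.mem_map.2 ⟨a, ha, rfl⟩))])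
  · exact congrArg List.prod (List.map_congr_left fun u hu => operand_ncEval_append W (hg u hu))

/-- **Block append**: a block reading only the gates before it evaluates gate by gate against the
earlier values. [cite: Nisan1991Noncommutative, §2] -/
theorem ncGateValues_append_block (gs blk : List (Gate R σ))
    (h : ∀ b ∈ blk, ∀ u ∈ b.args, u.RefsBelow gs.length) :
    ncGateValues (gs ++ blk) =
      ncGateValues gs ++ blk.map (fun b => b.ncEval (ncGateValues gs)) := by
  have hl : (ncGateValues gs).length = gs.length := by
    simpa using (ncGateValues_append_getD gs []).1
  induction blk using List.reverseRecOn with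
  | nil => simp
  | append_singleton blk b ih =>
    have hb : ∀ u ∈ b.args, u.RefsBelow (ncGateValues gs).length := fun u hu => by
      rw [hl]; exact h b (by simp) u hu
    rw [← List.append_assoc, ncGateValues_append_singleton,
      ih fun b' hb' => h b' (List.mem_append_left _ hb'), List.map_append, List.append_assoc,
      gate_ncEval_append _ hb, List.map_cons, List.map_nil]

/-- Weighted copies give the degree-`k` component of a sum. [cite: HrubesWigdersonYehudayoff2010] -/
theorem homOp_eval {d i k : ℕ} (hk1 : 1 ≤ k) (hkd : k ≤ d) {W V : List (FreeAlgebra R σ)}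
    (hW : W.length = i)
    (hV : ∀ j < i, ∀ k', 1 ≤ k' → k' ≤ d → V.getD (hix d j k') 0 = degPart d k' (W.getD j 0))
    (args : List (R × Operand R σ)) :
    (Gate.sum (args.filterMap (homOp d i k))).ncEval V =
      degPart d k ((Gate.sum args).ncEval W) := by
  induction args with
  | nil => simp [Gate.ncEval]
  | cons a args ih =>
    simp only [Gate.ncEval, Operand.ncEval] at ih
    obtain ⟨c, x | c' | j⟩ := a
    · by_cases h1 : k = 1
      · subst h1
        rw [List.filterMap_cons_some
          (by simp [homOp] : homOp d i 1 (c, Operand.var x) = some (c, Operand.var x))]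
        simp only [Gate.ncEval, List.map_cons, List.sum_cons, map_add, map_smul, ih,
          Operand.ncEval, degPart_one_ι hkd]
      · rw [List.filterMap_cons_none (by simp [homOp, h1] : homOp d i k (c, Operand.var x) = none)]
        simp only [Gate.ncEval, List.map_cons, List.sum_cons, map_add, map_smul, ih,
          Operand.ncEval, degPart_ι_eq_zero (show 2 ≤ k by omega) hkd, smul_zero, zero_add]
    · rw [List.filterMap_cons_none (by simp [homOp] : homOp d i k (c, Operand.const c') = none)]
      simp only [Gate.ncEval, List.map_cons, List.sum_cons, map_add, map_smul, ih,
        Operand.ncEval, degPart_algebraMap_eq_zero hk1 hkd, smul_zero, zero_add]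
    · by_cases hj : j < i
      · rw [List.filterMap_cons_some (by simp [homOp, hj] :
          homOp d i k (c, Operand.gate j) = some (c, Operand.gate (hix d j k)))]
        simp only [Gate.ncEval, List.map_cons, List.sum_cons, map_add, map_smul, ih,
          Operand.ncEval, hV j hj k hk1 hkd]
      · rw [List.filterMap_cons_none (by simp [homOp, hj] : homOp d i k (c, Operand.gate j) = none)]
        simp only [Gate.ncEval, List.map_cons, List.sum_cons, ih, Operand.ncEval,
          List.getD_eq_default _ _ (show W.length ≤ j by omega), smul_zero, zero_add]

/-- Skew fan-in-two products, slot by slot: `g_j · x`, the rotated `x · g_j`, scalar factors,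
`x · y`. [cite: HrubesWigdersonYehudayoff2010, Lemma 3.3] [cite: LimayeMalodSrinivasan2016, §7] -/
theorem homMul_eval {d i k : ℕ} (hk1 : 1 ≤ k) (hkd : k ≤ d) {W V : List (FreeAlgebra R σ)}
    (hW : W.length = i) {κ : ℕ → R}
    (hκ : ∀ j < i, algebraMap R (FreeAlgebra R σ) (κ j) = degPart d 0 (W.getD j 0))
    (hV : ∀ j < i, ∀ k', 1 ≤ k' → k' ≤ d → V.getD (hix d j k') 0 = degPart d k' (W.getD j 0))
    (u v : Operand R σ) (hs : (Gate.prod [u, v]).IsSkew) :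
    (homMul d κ i k u v).ncEval V = degPart d k (u.ncEval W * v.ncEval W) := by
  have hsc : ∀ (c : R) (o : Operand R σ),
      (Gate.sum ([(c, o)].filterMap (homOp d i k))).ncEval V = degPart d k (c • o.ncEval W) :=
    fun c o => by rw [homOp_eval hk1 hkd hW hV]; simp [Gate.ncEval]
  have h0 : ∀ j, ¬j < i → W[j]? = none := fun j hj => List.getElem?_eq_none (by omega)
  cases u with
  | var x =>
    cases v with
    | var y =>
      simp only [Operand.ncEval, degPart_ι_mul hk1 hkd]
      by_cases h2 : k = 2
      · rw [show homMul d κ i k (.var x) (.var y) = .prod [.var x, .var y] by simp [homMul, h2],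
          show k - 1 = 1 by omega, degPart_one_ι (by omega)]
        simp [Gate.ncEval, Operand.ncEval]
      · rw [show homMul d κ i k (.var x) (.var y) = .sum [] by simp [homMul, h2]]
        rcases Nat.lt_or_ge k 2 with h | h
        · rw [show k - 1 = 0 by omega, degPart_zero_ι, mul_zero]; simp [Gate.ncEval]
        · rw [degPart_ι_eq_zero (by omega) (by omega), mul_zero]; simp [Gate.ncEval]
    | const c =>
      exact (hsc c (.var x)).trans (by simp only [Operand.ncEval, mul_algebraMap_eq_smul])
    | gate j =>
      by_cases hj : j < i
      · rcases Nat.lt_or_ge k 2 with hk | hk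
        · obtain rfl : k = 1 := by omega
          rw [show homMul d κ i 1 (.var x) (.gate j) =
            .sum ([(κ j, Operand.var x)].filterMap (homOp d i 1)) by simp [homMul, hj], hsc]
          simp only [Operand.ncEval, map_smul]
          rw [degPart_one_ι hkd, degPart_ι_mul le_rfl hkd, Nat.sub_self, ← hκ j hj,
            mul_algebraMap_eq_smul]
        · rw [show homMul d κ i k (.var x) (.gate j) = .prod [.var x, .gate (hix d j (k - 1))] by
            simp [homMul, hj, hk]]
          simp only [Gate.ncEval, Operand.ncEval, List.map_cons, List.map_nil, List.prod_cons,
            List.prod_nil, mul_one, hV j hj (k - 1) (by omega) (by omega), degPart_ι_mul hk1 hkd]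
      · simp [homMul, hj, Gate.ncEval, Operand.ncEval, h0 j hj]
  | const c =>
    cases v with
    | var y => exact (hsc c (.var y)).trans (by simp only [Operand.ncEval, algebraMap_mul_eq_smul])
    | const c' =>
      show (Gate.sum [] : Gate R σ).ncEval V = _
      simp only [Gate.ncEval, Operand.ncEval, List.map_nil, List.sum_nil]
      rw [← map_mul (algebraMap R (FreeAlgebra R σ)), degPart_algebraMap_eq_zero hk1 hkd]
    | gate j =>
      exact (hsc c (.gate j)).trans (by simp only [Operand.ncEval, algebraMap_mul_eq_smul])
  | gate j =>
    cases v with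
    | var x =>
      by_cases hj : j < i
      · rcases Nat.lt_or_ge k 2 with hk | hk
        · obtain rfl : k = 1 := by omega
          rw [show homMul d κ i 1 (.gate j) (.var x) =
            .sum ([(κ j, Operand.var x)].filterMap (homOp d i 1)) by simp [homMul, hj], hsc]
          simp only [Operand.ncEval, map_smul]
          rw [degPart_one_ι hkd, degPart_mul_ι le_rfl hkd, Nat.sub_self, ← hκ j hj,
            algebraMap_mul_eq_smul]
        · rw [show homMul d κ i k (.gate j) (.var x) = .prod [.gate (hix d j (k - 1)), .var x] by
            simp [homMul, hj, hk]]
          simp only [Gate.ncEval, Operand.ncEval, List.map_cons, List.map_nil, List.prod_cons,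
            List.prod_nil, mul_one, hV j hj (k - 1) (by omega) (by omega), degPart_mul_ι hk1 hkd]
      · simp [homMul, hj, Gate.ncEval, Operand.ncEval, h0 j hj]
    | const c =>
      exact (hsc c (.gate j)).trans (by simp only [Operand.ncEval, mul_algebraMap_eq_smul])
    | gate j' => exact absurd hs (by simp [Gate.IsSkew, Operand.isGateRef])

/-- Every slot of a fan-in-two skew gate computes the degree-`k` component of the gate's value,
given the block invariant below block `i`. [cite: HrubesWigdersonYehudayoff2010, Lemma 3.3] -/
theorem homSlot_eval {d i k : ℕ} (hk1 : 1 ≤ k) (hkd : k ≤ d) {W V : List (FreeAlgebra R σ)}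
    (hW : W.length = i) {κ : ℕ → R}
    (hκ : ∀ j < i, algebraMap R (FreeAlgebra R σ) (κ j) = degPart d 0 (W.getD j 0))
    (hV : ∀ j < i, ∀ k', 1 ≤ k' → k' ≤ d → V.getD (hix d j k') 0 = degPart d k' (W.getD j 0))
    (g : Gate R σ) (h2 : g.fanIn ≤ 2) (hs : g.IsSkew) :
    (homSlot d κ i k g).ncEval V = degPart d k (g.ncEval W) := by
  rcases g with args | (_ | ⟨u, _ | ⟨v, _ | ⟨w, t⟩⟩⟩)
  · exact homOp_eval hk1 hkd hW hV args
  · rw [show (Gate.prod [] : Gate R σ).ncEval W = algebraMap R (FreeAlgebra R σ) 1 by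
      simp [Gate.ncEval], degPart_algebraMap_eq_zero hk1 hkd]
    show (Gate.sum [] : Gate R σ).ncEval V = 0; simp [Gate.ncEval]
  · rw [show (Gate.prod [u]).ncEval W = (Gate.sum [((1 : R), u)]).ncEval W by simp [Gate.ncEval]]
    exact homOp_eval hk1 hkd hW hV [((1 : R), u)]
  · rw [show (Gate.prod [u, v]).ncEval W = u.ncEval W * v.ncEval W by simp [Gate.ncEval]]
    exact homMul_eval hk1 hkd hW hκ hV u v hs
  · have h3 : (Gate.prod (u :: v :: w :: t)).fanIn = t.length + 3 := rfl
    omega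

/-- **Block invariant**: slot `(j, k)` of the translation computes the degree-`k` component of the
value of gate `j` (`1 ≤ k ≤ d`). [cite: HrubesWigdersonYehudayoff2010, Lemma 3.3] -/
theorem homBlocks_values (d : ℕ) (gs : List (Gate R σ)) (h2 : ∀ g ∈ gs, g.fanIn ≤ 2)
    (hs : ∀ g ∈ gs, g.IsSkew) (κ : ℕ → R)
    (hκ : ∀ j < gs.length,
      algebraMap R (FreeAlgebra R σ) (κ j) = degPart d 0 ((ncGateValues gs).getD j 0)) :
    (ncGateValues (homBlocks d κ 0 gs)).length = (d + 1) * gs.length ∧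
      ∀ j < gs.length, ∀ k, 1 ≤ k → k ≤ d →
        (ncGateValues (homBlocks d κ 0 gs)).getD (hix d j k) 0 =
          degPart d k ((ncGateValues gs).getD j 0) := by
  have hl : ∀ L : List (Gate R σ), (ncGateValues L).length = L.length := fun L => by
    simpa using (ncGateValues_append_getD L []).1
  refine ⟨by rw [hl, length_homBlocks], ?_⟩
  induction gs using List.reverseRecOn with
  | nil => exact fun j hj => absurd hj (Nat.not_lt_zero j)
  | append_singleton gs g ih =>
    intro j hj k hk1 hkd
    have hlen : (ncGateValues (homBlocks d κ 0 gs)).length = (d + 1) * gs.length := by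
      rw [hl, length_homBlocks]
    have hpre := (ncGateValues_append_getD gs [g]).2
    have hκ' : ∀ j < gs.length, algebraMap R (FreeAlgebra R σ) (κ j) =
        degPart d 0 ((ncGateValues gs).getD j 0) := fun j hj => by
      rw [← hpre j hj]; exact hκ j (by rw [List.length_append, List.length_singleton]; omega)
    have hv := ih (fun g' hg' => h2 g' (List.mem_append_left _ hg'))
      (fun g' hg' => hs g' (List.mem_append_left _ hg')) hκ'
    rw [homBlocks_append, Nat.zero_add, ncGateValues_append_block _ _ fun b hb u hu => by
      rw [length_homBlocks, Nat.mul_comm]; exact homBlock_refsBelow d κ gs.length g b hb u hu]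
    rcases Nat.lt_or_ge j gs.length with hj' | hj'
    · rw [List.getD_append _ _ _ _ (by rw [hlen]; exact hix_lt hj' hkd), hv j hj' k hk1 hkd,
        hpre j hj']
    · obtain rfl : j = gs.length := by
        rw [List.length_append, List.length_singleton] at hj; omega
      have hk : k < (homBlock d κ gs.length g).length := by
        simp only [homBlock, List.length_map, List.length_range]; omega
      have hsl : (homBlock d κ gs.length g)[k] =
          if k = 0 then Gate.sum [] else homSlot d κ gs.length k g := by simp [homBlock]
      rw [show hix d gs.length k = (ncGateValues (homBlocks d κ 0 gs)).length + k by
          rw [hlen, hix, Nat.mul_comm], List.getD_append_right _ _ _ _ (Nat.le_add_right _ _),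
        Nat.add_sub_cancel_left, List.getD_eq_getElem _ _ (by rw [List.length_map]; exact hk),
        List.getElem_map, hsl, if_neg (by omega), ncGateValues_getD_length]
      exact homSlot_eval hk1 hkd (hl gs) hκ' hv g (h2 g (by simp)) (hs g (by simp))

/-- **Semantics of the translation**: for a fan-in-two SKEW circuit computing a homogeneous
polynomial of degree `d ≥ 1`, `skewHom d P` computes it. [cite: HrubesWigdersonYehudayoff2010] -/
theorem ncEval_skewHom {d : ℕ} (hd : 1 ≤ d) (P : ArithCircuit R σ) (h2 : P.IsFanInTwo)
    (hs : P.IsSkew) (hf : degPart d d P.ncEval = P.ncEval) : (skewHom d P).ncEval = P.ncEval := by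
  have hG : ∀ g ∈ P.gates ++ [Gate.prod [P.output]], g.fanIn ≤ 2 ∧ g.IsSkew := fun g hg => by
    rcases List.mem_append.1 hg with hg | hg
    · exact ⟨h2 g hg, hs g hg⟩
    · rw [List.mem_singleton.1 hg]; exact ⟨show [P.output].length ≤ 2 by simp,
        show [P.output].countP Operand.isGateRef ≤ 1 from List.countP_le_length.trans (by simp)⟩
  have hv := (homBlocks_values d _ (fun g hg => (hG g hg).1) (fun g hg => (hG g hg).2)
    (kappa (P.gates ++ [Gate.prod [P.output]])) fun j _ => (degPart_zero_eq d _).symm).2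
    P.gates.length (by simp) d hd le_rfl
  rw [ncGateValues_getD_length, show (Gate.prod [P.output]).ncEval (ncGateValues P.gates) =
      P.ncEval by simp [Gate.ncEval, ArithCircuit.ncEval], hf] at hv
  exact hv

/-- **THE ARROW `SKEW ⊆ rot-NF(comb)`**: every fan-in-two skew noncommutative circuit computing a
homogeneous polynomial of degree `d ≥ 1` is computed by a circuit rot-typed by the left comb with
`d` leaves, of size `(d+1)(size+1)`. MODEL (module docstring): rot-NF(comb) ⊆ rotation-UPT NORMAL
FORM, the conversion rotUPT → rot-NF is NOT formalised; says nothing about general or untyped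
circuits; `PerNotNcVP` / A_nc OPEN; NOT a new lower bound; 0 S-currency; closes NO item.
[cite: HrubesWigdersonYehudayoff2010, Lemma 3.3] [cite: LagardeLimayeSrinivasan2018, §3 Prop 7]
[cite: LimayeMalodSrinivasan2016, §7] -/
theorem exists_rot_of_skew (P : ArithCircuit R σ) (h2 : P.IsFanInTwo) (hs : P.IsSkew) {d : ℕ}
    (hd : 1 ≤ d) (hf : degPart d d P.ncEval = P.ncEval) :
    ∃ (Q : ArithCircuit R σ) (T : Shape) (ty : ℕ → List Bool), T.size = d ∧
      (∀ k (hk : k < Q.gates.length), GateRot T ty (ty k) Q.gates[k]) ∧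
      OpTyped T ty [] Q.output ∧ Q.ncEval = P.ncEval ∧ Q.size = (d + 1) * (P.size + 1) :=
  ⟨skewHom d P, comb d, hty d, size_comb hd, skewHom_typed d P, skewHom_output d P,
    ncEval_skewHom hd P h2 hs hf, size_skewHom d P⟩

/-- **THE ARROW `LEFT-SKEW ⊆ UPT-NF(comb)`**: without rotated products `x · g_j` (every letter
factor on the right, as in an algebraic branching program) the typed circuit is in UPT normal
form. MODEL (module docstring): conversion NOT formalised; says nothing about general or untyped
circuits; `PerNotNcVP` / A_nc OPEN; NOT a new lower bound; 0 S-currency; closes NO item.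
[cite: LagardeLimayeSrinivasan2018, §3 Prop 7] [cite: HrubesWigdersonYehudayoff2010, Lemma 3.3]
[cite: Nisan1991Noncommutative] -/
theorem exists_upt_of_leftSkew (P : ArithCircuit R σ) (h2 : P.IsFanInTwo) (hs : P.IsSkew)
    (hL : ∀ g ∈ P.gates, ∀ (x : σ) (j : ℕ), g ≠ Gate.prod [Operand.var x, Operand.gate j])
    {d : ℕ} (hd : 1 ≤ d) (hf : degPart d d P.ncEval = P.ncEval) :
    ∃ (Q : ArithCircuit R σ) (T : Shape) (ty : ℕ → List Bool), T.size = d ∧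
      (∀ k (hk : k < Q.gates.length), GateTyped T ty (ty k) Q.gates[k]) ∧
      OpTyped T ty [] Q.output ∧ Q.ncEval = P.ncEval ∧ Q.size = (d + 1) * (P.size + 1) :=
  ⟨skewHom d P, comb d, hty d, size_comb hd, skewHom_gateTyped d P hL, skewHom_output d P,
    ncEval_skewHom hd P h2 hs hf, size_skewHom d P⟩

end Semantics

section Transfer
variable (K : Type w) [Field K]

/-- **`LID_r` for skew circuits THROUGH the rotation-UPT rung**: `2^{(r+1)/3} ≤ 4r(4r+1)(size+1)`,
WEAKER than `lidPoly_skew` (`2^r ≤ (r+1)·size`); its content is the factorisation SKEW →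
rot-NF(comb) → `lidPoly_rot`. MODEL (module docstring): conversion NOT formalised; nothing about
general or untyped circuits; `PerNotNcVP` / A_nc OPEN; NOT a new lower bound; 0 S-currency;
closes NO item. [cite: LagardeLimayeSrinivasan2018, §4 Theorem 17]
[cite: HrubesWigdersonYehudayoff2010, §C] -/
theorem lidPoly_skew_of_rot {r : ℕ} (hr : 1 ≤ r) (P : ArithCircuit K (Fin 2)) (h2 : P.IsFanInTwo)
    (hs : P.IsSkew) (h : P.ncEval = lidPoly K r) :
    2 ^ ((r + 1) / 3) ≤ 4 * r * ((4 * r + 1) * (P.size + 1)) := by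
  obtain ⟨Q, T, ty, -, hg, ho, hQ, hsz⟩ :=
    exists_rot_of_skew P h2 hs (d := 4 * r) (by omega) (by rw [h]; exact degPart_lidPoly K r)
  have := lidPoly_rot K hr Q hg ho (hQ.trans h)
  rwa [hsz] at this

/-- **`PERM_n` for skew circuits THROUGH the rotation-UPT rung** (`4r ≤ n`, `1 ≤ r`): substitute
by `liftSubst` (fan-in and skewness kept, size unchanged, value `LID_r` by `perm_lift`), then
`lidPoly_skew_of_rot`; WEAKER than `ncPerPoly_skew`. MODEL (module docstring): conversion NOT
formalised; nothing about general or untyped circuits; `PerNotNcVP` / A_nc OPEN; NOT a new lower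
bound; 0 S-currency; closes NO item. [cite: LagardeLimayeSrinivasan2018, §4 Theorem 17]
[cite: HrubesWigdersonYehudayoff2010, Lemma C.5] [cite: LimayeMalodSrinivasan2016, §7] -/
theorem ncPerPoly_skew_of_rot {r n : ℕ} (hr : 1 ≤ r) (hn : 4 * r ≤ n)
    (P : ArithCircuit K (Fin n × Fin n)) (h2 : P.IsFanInTwo) (hs : P.IsSkew)
    (h : P.ncEval = ncPerPoly K n) :
    2 ^ ((r + 1) / 3) ≤ 4 * r * ((4 * r + 1) * (P.size + 1)) := by
  have hQ : (P.substIn (liftSubst K r n)).ncEval = lidPoly K r := by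
    rw [ncEval_substIn, h, perm_lift K hn]
  have := lidPoly_skew_of_rot K hr (P.substIn (liftSubst K r n)) (h2.substIn _) (hs.substIn _) hQ
  rwa [size_substIn] at this

end Transfer

end Summit.ValiantsHypothesis.ValiantsHypothesis.Theorems.NcSkewCombTypedPermanent
end
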